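import Mathlib
import HarnessLib
import Literature.MathematicalPhysics.QuantumLattice.KohnLuttinger
import Summits.HubbardSuperconductivity.HubbardSuperconductivity.Theorems.WeakCouplingBCSKlDualOrderFillingD035Upper
import Summits.HubbardSuperconductivity.HubbardSuperconductivity.Theorems.WeakCouplingBCSKlDualOrderFillingD035Lower
import Summits.HubbardSuperconductivity.HubbardSuperconductivity.Theorems.WeakCouplingBCSWcbcsKohnLuttingerB1gMuWindow

/-!
# Route `WeakCouplingBCS` / `KLProgramme` — the μ-BRACKET of `δ = 0.35` at `t' = 0`: `μ(1 − 7/20) ∈ [−4431/5000, −353/400]`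
# (HQ1 (ii) dual-ordered pair of the `B1g` Kohn–Luttinger rival margin; cell `gate-hubbard-kl`, seat hubbard-klscan-idea-3 r18)

The free-band chemical potential `μ(δ) = chemicalPotentialOfDensity (squareDispersion 1 0) (1 − δ)` at hole doping `δ = 7/20` lies in the
union `[−0.8862, −0.8825]` of the three `U1` cells of job j272077 (true value `−0.88477`), from the two kernel-certified filling bounds
`muDualD035_filling_lt : n(−4431/5000) < 13/20` (`…KlDualOrderFillingD035Upper`, circumscribed 80-trapezoid certificate) and
`muDualD035_filling_ge : 13/20 ≤ n(−353/400)` (`…KlDualOrderFillingD035Lower`, inscribed 121-gon) through the tree's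
`chemicalPotentialOfDensity_window`.  This file was split off the x-read 500-line `WeakCouplingBCSKlDualOrderBracketD035.lean`
(sha16 37eb6d9111794066; gate lint: proof files ≤ 400 lines) — theorem blocks byte-identical.  Folklore; no definitions.
A Kohn–Luttinger `O(U²)` channel statement is not ODLRO; nothing here proves superconductivity in the Hubbard model.
-/



noncomputable section

set_option linter.dupNamespace false

namespace Summit.HubbardSuperconductivity.HubbardSuperconductivity.Theorems

open Literature.MathematicalPhysics.QuantumLattice

/-- **`μ(0.35) ∈ [-4431/5000, -353/400] = [-0.8862, -0.8825]`**: the free-band chemical potential of the hole doping `δ = 7/20`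
(true value `-0.88477`), from `muDualD035_filling_lt : n(-0.8862) < 13/20` and `muDualD035_filling_ge : 13/20 ≤ n(-0.8825)` through
`chemicalPotentialOfDensity_window`. [folklore] -/
theorem muOfDoping_d035_mem_Icc :
    chemicalPotentialOfDensity (squareDispersion 1 0) (1 - 7 / 20) ∈ Set.Icc (-(4431 : ℝ) / 5000) (-(353 : ℝ) / 400) := by
  obtain ⟨-, -, -, H⟩ := chemicalPotentialOfDensity_window (μ₁ := (-(353 : ℝ) / 400)) (μ₂ := (-(4431 : ℝ) / 5000))
    (by norm_num) (by norm_num) (by norm_num)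
  have hlo := muDualD035_filling_ge
  have hhi := muDualD035_filling_lt
  refine H (7 / 20) ⟨?_, ?_⟩
  · linarith
  · linarith

/-- The same bracket with `ℚ`-cast ends, the shape consumed by `KlDualOrder.marginOrderT0_d005_d035_of_records` (`cend.mub = -4431/5000`,
`cend.mua = -353/400`). [folklore] -/
theorem muOfDoping_d035_mem_Icc_cast :
    chemicalPotentialOfDensity (squareDispersion 1 0) (1 - 7 / 20) ∈
      Set.Icc ((((-4431 : ℚ) / 5000 : ℚ)) : ℝ) ((((-353 : ℚ) / 400 : ℚ)) : ℝ) := by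
  obtain ⟨h₁, h₂⟩ := muOfDoping_d035_mem_Icc
  exact ⟨by push_cast; linarith, by push_cast; linarith⟩

end Summit.HubbardSuperconductivity.HubbardSuperconductivity.Theorems

end
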